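/-
Copyright (c) 2026 the pub-hodgecm-mathlib formalisation cell (harness21).  Prover seat hodgecm-mathlib-K2E1-p10 (g0), Track B ∕ K2-LIT, h413 = `stmt-HodgeConjecture-24833`,
line `K2_E1_TraceFormulaBeta`, campaign «EIS-WHITTAKER-3», «C2₃∕C3₃ CONCRETE» FILE F3-prep (bookkeeping for the assembly `K2E1WhittakerContinuationConcreteU3`).  2026-09-04.
-/
import Summits.HodgeConjecture.HodgeConjecture.Theorems.K2E1WhittakerBoundsUniformU2   -- ★ #1b (K2E2-p12): `coe_mem_primePowBall_iff_valuation_le`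
import Mathlib.NumberTheory.NumberField.CanonicalEmbedding.Basic
import HarnessLib

/-!
# K2·E1 — `K2E1WhittakerShellIndexU3` («C3₃ CONCRETE», bookkeeping): the archimedean comparison `‖ξ_∞‖_{mixedSpace} ≤ ‖(w ↦ w.embedding ξ)‖_∞` (the letter `hmle` of ★ C3₃-A
# with `m = 1`) and the SHELL INDEX `n(ξ, w) = ord_w ξ − e_w` of a nonzero `ξ` in the box `𝔭_w^{e_w}` (order honesty `hn` of ★ C2₃-A; a non-unit in-box coordinate has index `≥ 1`)

Track B ∕ K2-LIT, crux h413 = `stmt-HodgeConjecture-24833`; cell `hodgecm-mathlib`, squad K2, ENGINE E1.  THEOREMS ONLY; lane `--supports stmt-HodgeConjecture-24833 --as helper`.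
Pure bookkeeping over a number field `L` (Mathlib `WithZero.log`, `norm_eq_sup'_normAtPlace`; ★ `coe_mem_primePowBall_iff_valuation_le`); consumed by ★ F3 `K2E1WhittakerContinuationConcreteU3`.
* `norm_mixedEmbedding_le_norm_embedding`, `log_valuation_le_iff_mem_primePowBall`, `mem_shell_of_mem_primePowBall`, `one_le_shellIndex_of_valuation_ne`,
  `mem_primePowBall_zero_of_valuation_eq_one`, `coe_mem_adicCompletionIntegers_of_valuation_eq_one`, `valuation_ne_one_of_not_mem_primePowBall_zero`.
HONEST LABEL: HC_CM is proved only modulo the 7 printed citations (2 remaining named inputs: hLiu418 = `stmt-HodgeConjecture-24832`, h413 = `stmt-HodgeConjecture-24833`)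
until rung 0 closes; count-neutral.  References: [NeukirchANT1999] J. Neukirch, *Algebraic Number Theory*, Ch. II §3–§4 (valuations, `𝔭`-adic balls) · [Garrett2018] §2.8.
-/

set_option autoImplicit false
-- the mandated namespace repeats `HodgeConjecture.HodgeConjecture`, as in every `Theorems/*.lean` of this sub-problem
set_option linter.dupNamespace false

noncomputable section

open NumberField NumberField.InfinitePlace NumberField.mixedEmbedding IsDedekindDomain Set Filter
open scoped NNReal Classical
open Literature.NumberTheory.Automorphic
open Summit.HodgeConjecture.HodgeConjecture.Cruxes.H413.K2E1WhittakerBoundsUniformU2 (coe_mem_primePowBall_iff_valuation_le)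

namespace Summit.HodgeConjecture.HodgeConjecture.Cruxes.H413.K2E1WhittakerShellIndexU3

variable (L : Type) [Field L] [NumberField L]

/-- **`m = 1`**: `‖ξ_∞‖_{mixedSpace} ≤ ‖(w ↦ w.embedding ξ)‖_∞` (both are the sup over the infinite places of `|ξ|_w`; Mathlib `norm_eq_sup'_normAtPlace`, `normAtPlace_apply`,
`norm_embedding_eq`). [folklore] -/
theorem norm_mixedEmbedding_le_norm_embedding (ξ : L) : 1 * ‖mixedEmbedding L ξ‖ ≤ ‖fun w : InfinitePlace L => (w.embedding ξ : ℂ)‖ := by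
  rw [one_mul, norm_eq_sup'_normAtPlace]
  refine Finset.sup'_le _ _ fun w _ => ?_
  rw [normAtPlace_apply, ← InfinitePlace.norm_embedding_eq w ξ]
  exact norm_le_pi_norm (fun w : InfinitePlace L => (w.embedding ξ : ℂ)) w

variable {L}

/-- Box membership in terms of the logarithm of the valuation: for `ξ ≠ 0`, `(ξ : L_w) ∈ 𝔭_w^m ↔ log (val_w ξ) ≤ −m`. [cite: NeukirchANT1999, Ch. II §3] -/
theorem log_valuation_le_iff_mem_primePowBall (w : HeightOneSpectrum (𝓞 L)) {ξ : L} (hξ : ξ ≠ 0) (m : ℤ) :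
    WithZero.log (w.valuation L ξ) ≤ -m ↔ (ξ : w.adicCompletion L) ∈ primePowBall (w.adicCompletion L) m := by
  have hne : w.valuation L ξ ≠ 0 := (Valuation.ne_zero_iff _).2 hξ
  rw [coe_mem_primePowBall_iff_valuation_le, ← WithZero.log_le_iff_le_exp hne]

/-- **ORDER HONESTY**: for `ξ ≠ 0` in the box at `w` (`ξ ∈ 𝔭_w^{e}`), with the shell index `n := (−log(val_w ξ) − e).toNat` (`= ord_w ξ − e`), `ξ ∈ 𝔭_w^{e+n} ∖ 𝔭_w^{e+n+1}`. [cite: NeukirchANT1999, Ch. II §3] -/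
theorem mem_shell_of_mem_primePowBall (w : HeightOneSpectrum (𝓞 L)) {ξ : L} (hξ : ξ ≠ 0) {e : ℤ} (hbox : (ξ : w.adicCompletion L) ∈ primePowBall (w.adicCompletion L) e) :
    (ξ : w.adicCompletion L) ∈ primePowBall (w.adicCompletion L) (e + ((-WithZero.log (w.valuation L ξ) - e).toNat : ℕ)) ∧
      (ξ : w.adicCompletion L) ∉ primePowBall (w.adicCompletion L) (e + ((-WithZero.log (w.valuation L ξ) - e).toNat : ℕ) + 1) := by
  have h0 : WithZero.log (w.valuation L ξ) ≤ -e := (log_valuation_le_iff_mem_primePowBall w hξ e).2 hbox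
  have hnn : 0 ≤ -WithZero.log (w.valuation L ξ) - e := by linarith
  have hcast : (((-WithZero.log (w.valuation L ξ) - e).toNat : ℕ) : ℤ) = -WithZero.log (w.valuation L ξ) - e := Int.toNat_of_nonneg hnn
  refine ⟨(log_valuation_le_iff_mem_primePowBall w hξ _).1 (by rw [hcast]; linarith), fun h => ?_⟩
  have h1 := (log_valuation_le_iff_mem_primePowBall w hξ _).2 h
  rw [hcast] at h1
  linarith

/-- A non-unit in-box coordinate has shell index `≥ 1`: if `ξ ∈ 𝔭_w^{e}` and `val_w ξ ≠ exp(−e)` then `1 ≤ n`. [folklore] -/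
theorem one_le_shellIndex_of_valuation_ne (w : HeightOneSpectrum (𝓞 L)) {ξ : L} (hξ : ξ ≠ 0) {e : ℤ} (hbox : (ξ : w.adicCompletion L) ∈ primePowBall (w.adicCompletion L) e)
    (hne : w.valuation L ξ ≠ WithZero.exp (-e)) : 1 ≤ (-WithZero.log (w.valuation L ξ) - e).toNat := by
  have hne0 : w.valuation L ξ ≠ 0 := (Valuation.ne_zero_iff _).2 hξ
  have h0 : WithZero.log (w.valuation L ξ) ≤ -e := (log_valuation_le_iff_mem_primePowBall w hξ e).2 hbox
  have hlt : WithZero.log (w.valuation L ξ) < -e := by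
    refine lt_of_le_of_ne h0 fun h => hne ?_
    rw [← WithZero.exp_log hne0, h]
  have h1 : (1 : ℤ) ≤ -WithZero.log (w.valuation L ξ) - e := by linarith
  exact (Int.le_toNat (by linarith)).2 h1

/-- A unit coordinate lies in the trivial box: `val_w ξ = 1 ⟹ (ξ : L_w) ∈ 𝔭_w^0 = 𝒪_w`. [folklore] -/
theorem mem_primePowBall_zero_of_valuation_eq_one (w : HeightOneSpectrum (𝓞 L)) {ξ : L} (h : w.valuation L ξ = 1) :
    (ξ : w.adicCompletion L) ∈ primePowBall (w.adicCompletion L) 0 := by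
  rw [coe_mem_primePowBall_iff_valuation_le, h, neg_zero, WithZero.exp_zero]

/-- …and is `w`-integral. [folklore] -/
theorem coe_mem_adicCompletionIntegers_of_valuation_eq_one (w : HeightOneSpectrum (𝓞 L)) {ξ : L} (h : w.valuation L ξ = 1) :
    (ξ : w.adicCompletion L) ∈ w.adicCompletionIntegers L := by
  rw [HeightOneSpectrum.mem_adicCompletionIntegers, HeightOneSpectrum.valuedAdicCompletion_eq_valuation', h]

/-- Off the trivial box the coordinate is not a unit: `(ξ : L_w) ∉ 𝔭_w^0 ⟹ val_w ξ ≠ 1`. [folklore] -/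
theorem valuation_ne_one_of_not_mem_primePowBall_zero (w : HeightOneSpectrum (𝓞 L)) {ξ : L} (h : (ξ : w.adicCompletion L) ∉ primePowBall (w.adicCompletion L) 0) :
    w.valuation L ξ ≠ 1 := fun h1 => h (mem_primePowBall_zero_of_valuation_eq_one w h1)

end Summit.HodgeConjecture.HodgeConjecture.Cruxes.H413.K2E1WhittakerShellIndexU3

end
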